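import Summits.KontsevichZagierPeriods.Zeta5Search.LaiSweepJump

/-!
# Order-cell sweep certificates for the `κ₃` point, 3/6: breakpoint-free cells

HONEST FRAMING. Systematic-search bookkeeping for the `κ₃` point `(74, 2180, 444; δ74)` of
`LaiKappa3Assembly`; no irrationality claim unless certified — this file checks no shard of the `κ₃`
sweep and proves nothing about `ζ(5)`.

`Free d u v` says that `d·z ∉ ℤ` for `z ∈ (u, v)`. The bitmask cover check `coverCheck ts mods B`
guarantees that every slope `|a_T|` and every difference `|a_T − a_T'|` of `y`-terms divides some
modulus in `mods` (`cover_of_check`), and `nextBreak mods p q = min (1, min_m (⌊m p/q⌋ + 1)/m)` is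
free for every `m ∈ mods` (`free_nextBreak`); hence the open cell `(p/q, nextBreak)` is free for all
needed `d` (`freeAll_of_mods`), every floor `⌊a x⌋` on it equals the exact right limit `flP a p q`
(`floor_eq_flP`), and `q·(a u − flP) = tpn a p q ∈ ℕ` (`tpn_spec`).

## Main results

* `Sweep.cover_of_check`, `Sweep.freeAll_of_mods`, `Sweep.free_nextBreak`, `Sweep.nextBreak_le_one`.
* `Sweep.floor_eq_flP`, `Sweep.tpn_spec`.
-/

open Finset Literature.NumberTheory.Transcendental.Zudilin2004
open Literature.NumberTheory.Transcendental.Zudilin2004.PhiCert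

namespace Summit.KontsevichZagierPeriods.Zeta5Search

open SavingCheck

namespace Sweep

/-! ### Soundness, IV: breakpoint-free cells -/

/-- No breakpoint `n/d` of slope `d` lies in the open interval `(u, v)`. [folklore] -/
def Free (d : ℤ) (u v : ℚ) : Prop := ∀ z : ℚ, u < z → z < v → ∀ n : ℤ, (d : ℚ) * z ≠ n

/-- A divisor of a free modulus is free. [folklore] -/
theorem free_of_dvd {d : ℤ} {m : ℕ} (hdm : d ∣ (m : ℤ)) {u v : ℚ} (h : Free m u v) :
    Free d u v := by
  intro z hu hv n hn
  obtain ⟨e, he⟩ := hdm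
  apply h z hu hv (e * n)
  have : ((m : ℤ) : ℚ) = (d : ℚ) * e := by exact_mod_cast he
  rw [this, mul_assoc, mul_comm (e : ℚ) z, ← mul_assoc, hn]; push_cast; ring

/-- Freeness is invariant under sign. [folklore] -/
theorem free_neg {d : ℤ} {u v : ℚ} (h : Free d u v) : Free (-d) u v := by
  intro z hu hv n hn
  apply h z hu hv (-n)
  push_cast at hn ⊢
  linarith

/-- Freeness of `|d|` gives freeness of `d`. [folklore] -/
theorem free_of_natAbs {d : ℤ} {u v : ℚ} (h : Free (d.natAbs : ℤ) u v) : Free d u v := by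
  rcases Int.natAbs_eq d with hd | hd
  · rw [← hd] at h; exact h
  · have := free_neg h; rw [← hd] at this; exact this

/-- The needed moduli: the slopes and the pairwise differences of the `y`-slopes. [folklore] -/
def diffsOf (ts : List Term) : List ℕ :=
  ts.map (fun T => T.a.natAbs) ++
    (ts.filter isY).flatMap fun T₁ => (ts.filter isY).map fun T₂ => (T₁.a - T₂.a).natAbs

/-- An oracle bitmask of a list of small naturals (its semantics is never used; the `bif` forces the
kernel to evaluate eagerly). [folklore] -/
def maskOf : List ℕ → ℕ → ℕ
  | [], m => m
  | d :: ds, m => let m' := m ||| (1 <<< d); bif m' == 0 then 0 else maskOf ds m'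

/-- The cover check: every modulus is positive and every needed modulus divides a listed one (the
bitmask only links the two decidable scans). [folklore] -/
def coverCheck (ts : List Term) (mods : List ℕ) (bound : ℕ) : Bool :=
  let ds := diffsOf ts
  let mask := maskOf ds 0
  (mods.all fun m => decide (0 < m)) &&
  (ds.all fun d => (d == 0) || (decide (d < bound) && mask.testBit d)) &&
  ((List.range bound).all fun d => (d == 0) || !mask.testBit d || mods.any fun m => m % d == 0)

/-- What the cover check establishes. [folklore] -/
theorem cover_of_check {ts : List Term} {mods : List ℕ} {bound : ℕ}
    (h : coverCheck ts mods bound = true) :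
    (∀ m ∈ mods, 0 < m) ∧ ∀ d ∈ diffsOf ts, d ≠ 0 → ∃ m ∈ mods, d ∣ m := by
  simp only [coverCheck, Bool.and_eq_true, List.all_eq_true, decide_eq_true_eq, Bool.or_eq_true,
    beq_iff_eq, List.mem_range, Bool.not_eq_true', List.any_eq_true] at h
  obtain ⟨⟨hpos, h1⟩, h2⟩ := h
  refine ⟨hpos, fun d hd hd0 => ?_⟩
  rcases h1 d hd with h | ⟨hlt, hbit⟩
  · exact absurd h hd0
  rcases h2 d hlt with (h | h) | ⟨m, hm, hmd⟩
  · exact absurd h hd0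
  · rw [hbit] at h; exact absurd h (by simp)
  · exact ⟨m, hm, Nat.dvd_of_mod_eq_zero hmd⟩

/-- All needed slopes are breakpoint-free on `(u, v)`. [folklore] -/
def FreeAll (ts : List Term) (u v : ℚ) : Prop := ∀ d ∈ diffsOf ts, d ≠ 0 → Free (d : ℤ) u v

/-- Free moduli covering the difference set make the cell breakpoint-free. [folklore] -/
theorem freeAll_of_mods {ts : List Term} {mods : List ℕ} {bound : ℕ}
    (h : coverCheck ts mods bound = true) {u v : ℚ} (hf : ∀ m ∈ mods, Free (m : ℤ) u v) :
    FreeAll ts u v := by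
  intro d hd hd0
  obtain ⟨m, hm, hdm⟩ := (cover_of_check h).2 d hd hd0
  exact free_of_dvd (Int.natCast_dvd_natCast.2 hdm) (hf m hm)

/-- A slope is free on a breakpoint-free cell. [folklore] -/
theorem FreeAll.slope {ts : List Term} {u v : ℚ} (h : FreeAll ts u v) {T : Term} (hT : T ∈ ts)
    (ha : T.a ≠ 0) : Free T.a u v := by
  apply free_of_natAbs
  apply h
  · exact List.mem_append_left _ (List.mem_map.2 ⟨T, hT, rfl⟩)
  · simpa using ha

/-- A difference of two jump slopes is free on a breakpoint-free cell. [folklore] -/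
theorem FreeAll.pair {ts : List Term} {u v : ℚ} (h : FreeAll ts u v) {T₁ T₂ : Term}
    (h₁ : T₁ ∈ ts.filter isY) (h₂ : T₂ ∈ ts.filter isY) (ha : T₁.a ≠ T₂.a) :
    Free (T₁.a - T₂.a) u v := by
  apply free_of_natAbs
  apply h
  · exact List.mem_append_right _ (List.mem_flatMap.2 ⟨T₁, h₁, List.mem_map.2 ⟨T₂, h₂, rfl⟩⟩)
  · simpa [sub_eq_zero] using ha

/-- **The next breakpoint**: `nbAux` returns a positive denominator and a value below every
candidate
`(⌊m u⌋ + 1)/m` and below the initial one. [folklore] -/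
theorem nbAux_spec (p q : ℕ) : ∀ (ms : List ℕ) (n₀ m₀ : ℕ), 0 < m₀ → (∀ m ∈ ms, 0 < m) →
    0 < (nbAux p q ms n₀ m₀).2 ∧
    ((nbAux p q ms n₀ m₀).1 : ℚ) / (nbAux p q ms n₀ m₀).2 ≤ (n₀ : ℚ) / m₀ ∧
    ∀ m ∈ ms, ((nbAux p q ms n₀ m₀).1 : ℚ) / (nbAux p q ms n₀ m₀).2 ≤ ((m * p / q + 1 : ℕ) : ℚ) / m
  | [], n₀, m₀, h0, _ => ⟨h0, le_rfl, fun m hm => by simp at hm⟩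
  | m :: ms, n₀, m₀, h0, hms => by
    have hm : 0 < m := hms m (by simp)
    have hms' : ∀ m' ∈ ms, 0 < m' := fun m' h => hms m' (by simp [h])
    have hm' : (0 : ℚ) < m := by exact_mod_cast hm
    have h0' : (0 : ℚ) < m₀ := by exact_mod_cast h0
    simp only [nbAux]
    set n := m * p / q + 1 with hn
    split_ifs with hlt
    · obtain ⟨ih0, ih1, ih2⟩ := nbAux_spec p q ms n m hm hms'
      have hnm : (n : ℚ) / m ≤ (n₀ : ℚ) / m₀ := by
        rw [div_le_div_iff₀ hm' h0']; exact_mod_cast hlt.le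
      refine ⟨ih0, ih1.trans hnm, fun m' hm'' => ?_⟩
      rcases List.mem_cons.1 hm'' with rfl | hm''
      · exact ih1
      · exact ih2 m' hm''
    · obtain ⟨ih0, ih1, ih2⟩ := nbAux_spec p q ms n₀ m₀ h0 hms'
      have hnm : (n₀ : ℚ) / m₀ ≤ (n : ℚ) / m := by
        rw [div_le_div_iff₀ h0' hm']; exact_mod_cast (not_lt.1 hlt)
      refine ⟨ih0, ih1, fun m' hm'' => ?_⟩
      rcases List.mem_cons.1 hm'' with rfl | hm''
      · exact ih1.trans hnm
      · exact ih2 m' hm''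

/-- The cell `(u, nextBreak u)` is free for every listed modulus. [folklore] -/
theorem free_nextBreak {mods : List ℕ} (hpos : ∀ m ∈ mods, 0 < m) {p q : ℕ} (hq : 0 < q)
    {m : ℕ} (hm : m ∈ mods) :
    Free (m : ℤ) ((p : ℚ) / q) (((nextBreak mods p q).1 : ℚ) / (nextBreak mods p q).2) := by
  obtain ⟨_, _, h2⟩ := nbAux_spec p q mods 1 1 one_pos hpos
  have hv := h2 m hm
  intro z hu hzv N hN
  have hm0 : 0 < m := hpos m hm
  have hm' : (0 : ℚ) < m := by exact_mod_cast hm0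
  have hq' : (0 : ℚ) < q := by exact_mod_cast hq
  -- D := m p / q satisfies q D ≤ m p, so D ≤ m u < m z = N, hence D + 1 ≤ N
  set D := m * p / q with hD
  have hDle : (D : ℚ) ≤ (m : ℚ) * ((p : ℚ) / q) := by
    have : ((q * D : ℕ) : ℚ) ≤ ((m * p : ℕ) : ℚ) := by exact_mod_cast Nat.mul_div_le (m * p) q
    push_cast at this
    rw [mul_div_assoc', le_div_iff₀ hq']; linarith
  have h1 : (D : ℚ) < N := by
    push_cast at hN
    calc (D : ℚ) ≤ m * (p / q) := hDle
      _ < m * z := by gcongr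
      _ = N := hN
  have h1' : ((D : ℤ) : ℚ) < (N : ℚ) := by exact_mod_cast h1
  have h2' : (D : ℤ) + 1 ≤ N := by exact_mod_cast (Int.cast_lt.1 h1')
  -- m z < m v ≤ D + 1 ≤ N
  have h3 : (m : ℚ) * z < ((D + 1 : ℕ) : ℚ) := by
    have := mul_lt_mul_of_pos_left hzv hm'
    rw [nextBreak] at this
    calc (m : ℚ) * z < m * (((nbAux p q mods 1 1).1 : ℚ) / (nbAux p q mods 1 1).2) := this
      _ ≤ m * (((D + 1 : ℕ) : ℚ) / m) := by gcongr
      _ = ((D + 1 : ℕ) : ℚ) := mul_div_cancel₀ _ hm'.ne'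
  have h4 : (N : ℚ) < (D : ℚ) + 1 := by push_cast at h3 hN; linarith
  have h5 : N < (D : ℤ) + 1 := by exact_mod_cast h4
  omega

/-- The right endpoint is at most `1`. [folklore] -/
theorem nextBreak_le_one {mods : List ℕ} (hpos : ∀ m ∈ mods, 0 < m) (p q : ℕ) :
    (((nextBreak mods p q).1 : ℚ) / (nextBreak mods p q).2) ≤ 1 := by
  obtain ⟨_, h1, _⟩ := nbAux_spec p q mods 1 1 one_pos hpos
  simpa [nextBreak] using h1

/-- **Floors on a free cell**: for `x ∈ (u, v)` free of the breakpoints of `a`, `⌊a x⌋ = flP a u`.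
[folklore] -/
theorem floor_eq_flP {a : ℤ} {p q : ℕ} (hq : 0 < q) {v x : ℚ} (hux : (p : ℚ) / q < x) (hxv : x < v)
    (hfree : a ≠ 0 → Free a ((p : ℚ) / q) v) : ⌊(a : ℚ) * x⌋ = flP a p q := by
  have hq' : (0 : ℚ) < q := by exact_mod_cast hq
  set u := (p : ℚ) / q with hu
  have hfl : (flfr a p q).1 = ⌊(a : ℚ) * u⌋ := by rw [flfr_fst a p q hq, hu, mul_div_assoc]
  have hfr : (((flfr a p q).2 : ℕ) : ℚ) / q = Int.fract ((a : ℚ) * u) := by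
    rw [flfr_snd a p q hq, hu, mul_div_assoc]
  -- no integer strictly between, via freeness
  have key : ∀ N : ℤ, a ≠ 0 → ¬ ((a : ℚ) * u < N ∧ (N : ℚ) < (a : ℚ) * x) ∧
      ¬ ((a : ℚ) * x < N ∧ (N : ℚ) < (a : ℚ) * u) := by
    intro N ha
    have ha' : (a : ℚ) ≠ 0 := by exact_mod_cast ha
    constructor
    · rintro ⟨h1, h2⟩
      -- z = N / a lies in (u, x) when a > 0
      rcases lt_or_gt_of_ne ha with hneg | hpos
      · have han : (a : ℚ) < 0 := by exact_mod_cast hneg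
        -- a < 0: a u < N < a x gives x < N/a < u, contradiction with u < x
        have : x < u := by nlinarith [h1, h2]
        linarith
      · have hap : (0 : ℚ) < a := by exact_mod_cast hpos
        refine hfree ha ((N : ℚ) / a) ?_ ?_ N (mul_div_cancel₀ _ ha')
        · rw [lt_div_iff₀ hap]; linarith
        · have : (N : ℚ) / a < x := by rw [div_lt_iff₀ hap]; linarith
          linarith
    · rintro ⟨h1, h2⟩
      rcases lt_or_gt_of_ne ha with hneg | hpos
      · have han : (a : ℚ) < 0 := by exact_mod_cast hneg
        refine hfree ha ((N : ℚ) / a) ?_ ?_ N (mul_div_cancel₀ _ ha')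
        · rw [lt_div_iff_of_neg han]; linarith
        · have : (N : ℚ) / a < x := by rw [div_lt_iff_of_neg han]; linarith
          linarith
      · have hap : (0 : ℚ) < a := by exact_mod_cast hpos
        have : x < u := by nlinarith [h1, h2]
        linarith
  have hexact : ∀ N : ℤ, a ≠ 0 → (a : ℚ) * x ≠ N := fun N ha h =>
    hfree ha x hux hxv N h
  by_cases ha : a = 0
  · subst ha; simp [flP, flfr, wrap]
  unfold flP wrap
  rcases lt_or_gt_of_ne ha with hneg | hpos
  · -- negative slope
    have han : (a : ℚ) < 0 := by exact_mod_cast hneg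
    have hax : (a : ℚ) * x < (a : ℚ) * u := by nlinarith
    by_cases h0 : (flfr a p q).2 = 0
    · -- wrap: a u = fl is an integer, floor drops by one
      have hint : (a : ℚ) * u = ((flfr a p q).1 : ℚ) := by
        have := (flfr_spec a p q hq).1
        rw [h0, Nat.cast_zero, zero_div, add_zero, mul_div_assoc, ← hu] at this
        exact this.symm
      simp only [hneg, decide_true, h0, beq_self_eq_true, Bool.and_self, cond_true]
      rw [Int.floor_eq_iff]
      push_cast
      constructor
      · by_contra hlt
        push Not at hlt
        exact (key ((flfr a p q).1 - 1) ha).2 ⟨by push_cast; linarith, by push_cast; linarith⟩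
      · have := hexact (flfr a p q).1 ha
        rcases lt_or_gt_of_ne this with h | h
        · linarith
        · linarith
    · have hb : (decide (a < 0) && ((flfr a p q).2 == 0)) = false := by simp [h0]
      rw [hb, cond_false, hfl, Int.floor_eq_iff]
      have hne : (a : ℚ) * u ≠ ⌊(a : ℚ) * u⌋ := by
        intro h
        apply h0
        have h2 : Int.fract ((a : ℚ) * u) = 0 := by rw [Int.fract]; exact sub_eq_zero.2 h
        have := hfr
        rw [h2, div_eq_zero_iff] at this
        rcases this with h3 | h3
        · exact_mod_cast h3
        · exact absurd h3 hq'.ne'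
      constructor
      · by_contra hlt
        push Not at hlt
        have hflu : (⌊(a : ℚ) * u⌋ : ℚ) < (a : ℚ) * u :=
          lt_of_le_of_ne (Int.floor_le _) (Ne.symm hne)
        exact (key ⌊(a : ℚ) * u⌋ ha).2 ⟨hlt, hflu⟩
      · linarith [Int.lt_floor_add_one ((a : ℚ) * u)]
  · -- positive slope: floor unchanged
    have hap : (0 : ℚ) < a := by exact_mod_cast hpos
    have hb : (decide (a < 0) && ((flfr a p q).2 == 0)) = false := by
      simp [not_lt.2 hpos.le]
    rw [hb, cond_false, hfl, Int.floor_eq_iff]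
    have hux' : (a : ℚ) * u < (a : ℚ) * x := by nlinarith
    constructor
    · linarith [Int.floor_le ((a : ℚ) * u)]
    · by_contra hge
      push Not at hge
      rcases hge.lt_or_eq with hgt | heq
      · exact (key (⌊(a : ℚ) * u⌋ + 1) ha).1
          ⟨by push_cast; linarith [Int.lt_floor_add_one ((a : ℚ) * u)], by push_cast; linarith⟩
      · exact hexact (⌊(a : ℚ) * u⌋ + 1) ha (by push_cast; linarith)

end Sweep

end Summit.KontsevichZagierPeriods.Zeta5Search
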